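import Mathlib
import HarnessLib
import Summits.AtomisticToContinuum.FouriersLaw.Theses.JunctionLocality
import Summits.AtomisticToContinuum.FouriersLaw.Theorems.JunctionLocalitySuperadditiveResistanceDeviceLiouville
import Summits.AtomisticToContinuum.FouriersLaw.Theorems.JunctionLocalitySuperadditiveResistanceDeviceBlockRestriction

/-!
# Termination locality in Kubo form, helper I: the defect equation of the block comparison
(stub `stub_terminationLocality` of line `floating-probe-bypass-laplacian`, crux
`JunctionLocality.SuperadditiveResistance`, stmt-AtomisticToContinuum-11748)

The stub (TL⁺, one-sided, `N`-uniform) compares the two-terminal Kubo conductance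
`G_N = γ(1 − (γ/T²)⟨g_N, p_0² − T⟩_{μ_T^N})` of the bare `N`-chain (`g_N` its left forward field,
`L_N^{T,T} g_N = −(p_0² − T)`) with the self-conductance
`K_00 = γ − (γ²/T²)⟨g_0, p_0² − T⟩_{μ_T^{N+M}}` of the left bath in the `(N, M)`-device
(`L_dev g_0 = −(p_0² − T)`, all four thermostats at `T`). This file proves the exact FIXED-`N`
skeleton of that comparison, with no `N`-uniform content:

* `deviceGenerator_comp_restrictLeft`: on a left-block function `f ∘ π_N` the device generator at
  equal temperatures is `(L_N^{T,T} f) ∘ π_N + V'(r_J) (∂_{p_{N−1}} f) ∘ π_N` (the landed block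
  restriction `pinnedChain_device_comp_restrictLeft`, read in the `deviceGenerator` vocabulary:
  the probe at `N−1` plays EXACTLY the bare chain's right bath);
* `deviceGenerator_defect`: **the defect equation** — for any classical solutions `g_0` (device,
  site `0`) and `g_N` (bare `N`-chain, left bath) the difference `u = g_0 − g_N ∘ π_N` solves
  `L_dev u = −V'(q_N − q_{N−1}) · (∂_{p_{N−1}} g_N) ∘ π_N` pointwise: the two forward fields differ
  by the response of the device to the junction force acting on the bare field's gradient at its
  γ-thermostatted end site, and by nothing else;
* `kuboMatrix_zero_zero_sub_plainKubo` / `kuboMatrix_three_three_sub_plainKubo`: the Kubo-form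
  bookkeeping `K_00 − G_N = −(γ²/T²)(⟨g_0, p_0² − T⟩_{μ^{N+M}} − ⟨g_N, p_0² − T⟩_{μ^N})` (and the
  right-block analogue with `K_33`, site `N+M−1`, the bare `M`-chain);
* `one_div_sub_one_div_le_of_defect`, `one_div_sub_one_div_le_of_sq_defect`: the pure real algebra
  turning a division-free conductance defect `K − G ≤ C·G·K` (resp. `≤ c G²`) into the stub's
  resistance form `1/G − 1/K ≤ C` for positive conductances.

The vocabulary `termSite`, `deviceForwardFields`, `plainForwardFields`, `plainKubo`, `kuboMatrix` is
copied VERBATIM from the registered skeleton (kept in this helper namespace, definitionally equal to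
the skeleton's copies, so statements transfer by `exact`). References: the Duhamel/resolvent
reduction of termination locality recorded in `…DeviceBlockRestriction`; Kubo matrix of a
multi-terminal Langevin network: Kundu–Dhar–Narayan, J. Stat. Mech. (2009) L03001; Rey-Bellet,
*Open classical systems* (2006) Rem. 4.4.
-/

noncomputable section

open MeasureTheory Filter Topology
open scoped ContDiff
open Literature.MathematicalPhysics.KineticTheory.HeatConduction
open Summit.AtomisticToContinuum.FouriersLaw.Theorems.SuperadditiveResistance.DeviceLiouville

namespace Summit.AtomisticToContinuum.FouriersLaw.Theorems.SuperadditiveResistance.TerminationLocality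

/-! ## Vocabulary (verbatim copies of the skeleton of line `floating-probe-bypass-laplacian`, §1) -/

/-- Terminal sites of the device for the split `(N, M)`: `0 ↦ 0` (left bath), `1 ↦ N−1`, `2 ↦ N` (the probe
pair), `3 ↦ N+M−1` (right bath). -/
def termSite (N M : ℕ) : Fin 4 → ℕ := ![0, N - 1, N, N + M - 1]

/-- The set of equilibrium FORWARD FIELDS of the device's terminal observable at site `s`:
classical `C²` solutions `g` of `L_dev g = −(p_s² − T)` (all four thermostats at `T`), square integrable and
mean zero for the Gibbs state `μ_T` (the clauses of the first lead's `IsForwardField` without its `S_K g ∈ L²`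
clause; a singleton or empty by the landed `forwardField_unique`). A solution SET (an object), not a proposition. -/
def deviceForwardFields (ω₂ lam β γ T : ℝ) (N M : ℕ) (s : ℕ) : Set (PhaseSpace (N + M) → ℝ) :=
  {g | ContDiff ℝ 2 g ∧ MemLp g 2 ((pinnedChain ω₂ lam β γ).gibbsMeasure (N + M) T) ∧
    ∫ x, g x ∂((pinnedChain ω₂ lam β γ).gibbsMeasure (N + M) T) = 0 ∧
    ∀ x, deviceGenerator (pinnedChain ω₂ lam β γ) N M (fun _ => T) g x = -(kin (N + M) s x - T)}

/-- The set of equilibrium forward fields of the LEFT bath of the plain `L`-chain: classical mean-zero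
`C² ∩ L²(μ_T)` solutions of `L_{T,T} g = −(p_0² − T)`. -/
def plainForwardFields (ω₂ lam β γ T : ℝ) (L : ℕ) : Set (PhaseSpace L → ℝ) :=
  {g | ContDiff ℝ 2 g ∧ MemLp g 2 ((pinnedChain ω₂ lam β γ).gibbsMeasure L T) ∧
    ∫ x, g x ∂((pinnedChain ω₂ lam β γ).gibbsMeasure L T) = 0 ∧
    ∀ x, (pinnedChain ω₂ lam β γ).generator L T T g x = -(kin L 0 x - T)}

/-- The plain chain's two-terminal KUBO CONDUCTANCE read off a left forward field:
`G = γ(1 − (γ/T²)⟨g, p_0² − T⟩_{μ_T})` (= `K_00` of the `2 × 2` Kubo matrix; by its zero row sum it is the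
linear-response current per unit bias `T_L − T_R`). -/
def plainKubo (ω₂ lam β γ T : ℝ) (L : ℕ) (g : PhaseSpace L → ℝ) : ℝ :=
  γ * (1 - γ / T ^ 2 * ∫ x, g x * (kin L 0 x - T) ∂((pinnedChain ω₂ lam β γ).gibbsMeasure L T))

/-- The device's four-terminal KUBO MATRIX from a family `g` of terminal forward fields:
`K_ab = γ δ_ab − (γ²/T²) ⟨g_a, p_{s_b}² − T⟩_{μ_T}` (`= ∂J_a/∂T_b`, `J_a = γ(T_a − ⟨p_{s_a}²⟩)`). -/
def kuboMatrix (ω₂ lam β γ T : ℝ) (N M : ℕ) (g : Fin 4 → PhaseSpace (N + M) → ℝ) :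
    Matrix (Fin 4) (Fin 4) ℝ :=
  fun a b => (if a = b then γ else 0) - γ ^ 2 / T ^ 2 *
    ∫ x, g a x * (kin (N + M) (termSite N M b) x - T) ∂((pinnedChain ω₂ lam β γ).gibbsMeasure (N + M) T)

/-! ## Block kinematics: the left-block coordinate map `π_N` -/

section Block

variable {N M : ℕ}

/-- The left-block coordinate map `π_N : (q, p) ↦ (q|_{0..N−1}, p|_{0..N−1})` of the split `(N, M)`
(the lambda `fun y => (y.1 ∘ Fin.castAdd M, y.2 ∘ Fin.castAdd M)` of `…DeviceBlockRestriction`,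
named). -/
def restrictLeft (N M : ℕ) (x : PhaseSpace (N + M)) : PhaseSpace N :=
  (x.1 ∘ Fin.castAdd M, x.2 ∘ Fin.castAdd M)

/-- Unfolding `restrictLeft`. -/
theorem restrictLeft_apply (x : PhaseSpace (N + M)) :
    restrictLeft N M x = (x.1 ∘ Fin.castAdd M, x.2 ∘ Fin.castAdd M) := rfl

/-- `f ∘ π_N` is the lambda form used in `…DeviceBlockRestriction`. -/
theorem comp_restrictLeft (f : PhaseSpace N → ℝ) :
    f ∘ restrictLeft N M =
      f ∘ fun y : PhaseSpace (N + M) => (y.1 ∘ Fin.castAdd M, y.2 ∘ Fin.castAdd M) := rfl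

/-- `π_N` is a continuous linear map, in particular smooth. -/
theorem contDiff_restrictLeft {n : WithTop ℕ∞} : ContDiff ℝ n (restrictLeft N M) := by
  unfold restrictLeft
  apply ContDiff.prodMk
  · exact contDiff_pi.2 fun i => (contDiff_apply ℝ ℝ (Fin.castAdd M i)).comp contDiff_fst
  · exact contDiff_pi.2 fun i => (contDiff_apply ℝ ℝ (Fin.castAdd M i)).comp contDiff_snd

/-- A `Cⁿ` block function lifts to a `Cⁿ` function of the device. -/
theorem contDiff_comp_restrictLeft {n : WithTop ℕ∞} {f : PhaseSpace N → ℝ} (hf : ContDiff ℝ n f) :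
    ContDiff ℝ n (f ∘ restrictLeft N M) :=
  hf.comp contDiff_restrictLeft

/-- The kinetic observable of a left-block site is a left-block function: `p_s²(π_N x) = p_s²(x)`
for `s < N`. -/
theorem kin_restrictLeft {s : ℕ} (hs : s < N) (x : PhaseSpace (N + M)) :
    kin N s (restrictLeft N M x) = kin (N + M) s x := by
  rw [kin_eq_sq hs, kin_eq_sq (show s < N + M by omega)]
  rfl

end Block

/-! ## The device generator on left-block functions and the defect equation -/

section Defect

variable {ω₂ lam β γ T : ℝ} {N M : ℕ}

/-- **Block restriction in the `deviceGenerator` vocabulary.** On a left-block function the device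
generator at equal terminal temperatures `T` is the bare `N`-chain's equilibrium generator
`L_N^{T,T}` (the probe at `N−1` is its right bath) plus the junction force
`V'(q_N − q_{N−1}) ∂_{p_{N−1}}`, `V'(r) = r + β r³`. -/
theorem deviceGenerator_comp_restrictLeft (ω₂ lam β γ T : ℝ) (hN : 1 ≤ N) (hM : 1 ≤ M)
    (f : PhaseSpace N → ℝ) (x : PhaseSpace (N + M)) :
    deviceGenerator (pinnedChain ω₂ lam β γ) N M (fun _ => T) (f ∘ restrictLeft N M) x =
      (pinnedChain ω₂ lam β γ).generator N T T f (restrictLeft N M x) +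
        ((x.1 ⟨N, by omega⟩ - x.1 ⟨N - 1, by omega⟩) +
            β * (x.1 ⟨N, by omega⟩ - x.1 ⟨N - 1, by omega⟩) ^ 3) *
          partialP ⟨N - 1, by omega⟩ f (restrictLeft N M x) := by
  have h := Cruxes.SuperadditiveResistance.ThermaliseThenCutProbeInsertion.pinnedChain_device_comp_restrictLeft
    ω₂ lam β γ hN hM (fun _ => T) f x
  simp only [deviceGenerator, thermo]
  exact h

/-- The device generator at equal temperatures is linear (subtraction) on `C²`. -/
theorem deviceGenerator_sub (P : OscillatorChain) (N M : ℕ) (T : ℝ)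
    {f g : PhaseSpace (N + M) → ℝ} (hf : ContDiff ℝ 2 f) (hg : ContDiff ℝ 2 g)
    (x : PhaseSpace (N + M)) :
    deviceGenerator P N M (fun _ => T) (fun y => f y - g y) x =
      deviceGenerator P N M (fun _ => T) f x - deviceGenerator P N M (fun _ => T) g x := by
  rw [deviceGenerator_eq, deviceGenerator_eq, deviceGenerator_eq,
    liouvilleOp_sub (hf.differentiable two_ne_zero) (hg.differentiable two_ne_zero),
    bathOp_sub hf hg]
  ring

/-- **The defect equation (fixed `N`, exact).** Let `g_0 ∈ C²` solve the device equation
`L_dev g_0 = −(p_0² − T)` and `g_N ∈ C²` the bare `N`-chain's `L_N^{T,T} g_N = −(p_0² − T)`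
(`N, M ≥ 1`). Then `u := g_0 − g_N ∘ π_N` solves, pointwise,
`L_dev u = −V'(q_N − q_{N−1}) · (∂_{p_{N−1}} g_N) ∘ π_N`:
the source `p_0² − T` cancels exactly (it is a left-block observable and the probe at `N−1`
reproduces the bare chain's right bath), and the ONLY defect is the junction force acting on the
bare field's momentum gradient at its γ-thermostatted end site. -/
theorem deviceGenerator_defect (ω₂ lam β γ T : ℝ) (hN : 1 ≤ N) (hM : 1 ≤ M)
    {g₀ : PhaseSpace (N + M) → ℝ} {gN : PhaseSpace N → ℝ} (hg₀ : ContDiff ℝ 2 g₀)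
    (hgN : ContDiff ℝ 2 gN)
    (hpde₀ : ∀ x, deviceGenerator (pinnedChain ω₂ lam β γ) N M (fun _ => T) g₀ x =
      -(kin (N + M) 0 x - T))
    (hpdeN : ∀ y, (pinnedChain ω₂ lam β γ).generator N T T gN y = -(kin N 0 y - T))
    (x : PhaseSpace (N + M)) :
    deviceGenerator (pinnedChain ω₂ lam β γ) N M (fun _ => T)
        (fun y => g₀ y - gN (restrictLeft N M y)) x =
      -(((x.1 ⟨N, by omega⟩ - x.1 ⟨N - 1, by omega⟩) +
            β * (x.1 ⟨N, by omega⟩ - x.1 ⟨N - 1, by omega⟩) ^ 3) *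
          partialP ⟨N - 1, by omega⟩ gN (restrictLeft N M x)) := by
  have hcomp : ContDiff ℝ 2 (gN ∘ restrictLeft N M) := contDiff_comp_restrictLeft hgN
  have h1 := deviceGenerator_sub (pinnedChain ω₂ lam β γ) N M T hg₀ hcomp x
  have h2 := deviceGenerator_comp_restrictLeft ω₂ lam β γ T hN hM gN x
  have h3 := hpdeN (restrictLeft N M x)
  rw [kin_restrictLeft (show 0 < N by omega)] at h3
  have h4 := hpde₀ x
  have e : (fun y => g₀ y - gN (restrictLeft N M y)) = fun y => g₀ y - (gN ∘ restrictLeft N M) y := rfl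
  rw [e, h1, h2, h3, h4]
  ring

/-- Unpacking a device forward field of terminal `0` (site `0`). -/
theorem mem_deviceForwardFields_iff {s : ℕ} {g : PhaseSpace (N + M) → ℝ} :
    g ∈ deviceForwardFields ω₂ lam β γ T N M s ↔
      ContDiff ℝ 2 g ∧ MemLp g 2 ((pinnedChain ω₂ lam β γ).gibbsMeasure (N + M) T) ∧
        ∫ x, g x ∂((pinnedChain ω₂ lam β γ).gibbsMeasure (N + M) T) = 0 ∧
        ∀ x, deviceGenerator (pinnedChain ω₂ lam β γ) N M (fun _ => T) g x =
          -(kin (N + M) s x - T) := Iff.rfl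

/-- Unpacking a plain forward field. -/
theorem mem_plainForwardFields_iff {L : ℕ} {g : PhaseSpace L → ℝ} :
    g ∈ plainForwardFields ω₂ lam β γ T L ↔
      ContDiff ℝ 2 g ∧ MemLp g 2 ((pinnedChain ω₂ lam β γ).gibbsMeasure L T) ∧
        ∫ x, g x ∂((pinnedChain ω₂ lam β γ).gibbsMeasure L T) = 0 ∧
        ∀ x, (pinnedChain ω₂ lam β γ).generator L T T g x = -(kin L 0 x - T) := Iff.rfl

/-- The defect equation for members of the skeleton's solution sets (`N, M ≥ 1`). -/
theorem deviceGenerator_defect_of_mem (hN : 1 ≤ N) (hM : 1 ≤ M)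
    {g₀ : PhaseSpace (N + M) → ℝ} {gN : PhaseSpace N → ℝ}
    (hg₀ : g₀ ∈ deviceForwardFields ω₂ lam β γ T N M 0) (hgN : gN ∈ plainForwardFields ω₂ lam β γ T N)
    (x : PhaseSpace (N + M)) :
    deviceGenerator (pinnedChain ω₂ lam β γ) N M (fun _ => T)
        (fun y => g₀ y - gN (restrictLeft N M y)) x =
      -(((x.1 ⟨N, by omega⟩ - x.1 ⟨N - 1, by omega⟩) +
            β * (x.1 ⟨N, by omega⟩ - x.1 ⟨N - 1, by omega⟩) ^ 3) *
          partialP ⟨N - 1, by omega⟩ gN (restrictLeft N M x)) :=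
  deviceGenerator_defect ω₂ lam β γ T hN hM hg₀.1 hgN.1 hg₀.2.2.2 hgN.2.2.2 x

end Defect

/-! ## Kubo-form bookkeeping -/

section Kubo

variable (ω₂ lam β γ T : ℝ)

/-- `termSite N M 0 = 0`. -/
@[simp] theorem termSite_zero (N M : ℕ) : termSite N M 0 = 0 := rfl

/-- `termSite N M 3 = N + M − 1`. -/
@[simp] theorem termSite_three (N M : ℕ) : termSite N M 3 = N + M - 1 := rfl

/-- `K_00 = γ − (γ²/T²)⟨g_0, p_0² − T⟩`. -/
theorem kuboMatrix_zero_zero (N M : ℕ) (g : Fin 4 → PhaseSpace (N + M) → ℝ) :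
    kuboMatrix ω₂ lam β γ T N M g 0 0 = γ - γ ^ 2 / T ^ 2 *
      ∫ x, g 0 x * (kin (N + M) 0 x - T) ∂((pinnedChain ω₂ lam β γ).gibbsMeasure (N + M) T) := by
  simp [kuboMatrix]

/-- `K_33 = γ − (γ²/T²)⟨g_3, p_{N+M−1}² − T⟩`. -/
theorem kuboMatrix_three_three (N M : ℕ) (g : Fin 4 → PhaseSpace (N + M) → ℝ) :
    kuboMatrix ω₂ lam β γ T N M g 3 3 = γ - γ ^ 2 / T ^ 2 *
      ∫ x, g 3 x * (kin (N + M) (N + M - 1) x - T) ∂((pinnedChain ω₂ lam β γ).gibbsMeasure (N + M) T) := by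
  simp [kuboMatrix]

/-- **Kubo-form bookkeeping of the left block.** `K_00 − G_N = −(γ²/T²)(⟨g_0, p_0² − T⟩_{μ^{N+M}} −
⟨g_N, p_0² − T⟩_{μ^N})`: termination locality is the comparison of ONE return pairing of the two
equilibrium dynamics (pure unfolding, any `g`, `g_N`). -/
theorem kuboMatrix_zero_zero_sub_plainKubo (N M : ℕ) (g : Fin 4 → PhaseSpace (N + M) → ℝ)
    (gN : PhaseSpace N → ℝ) :
    kuboMatrix ω₂ lam β γ T N M g 0 0 - plainKubo ω₂ lam β γ T N gN =
      -(γ ^ 2 / T ^ 2) *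
        ((∫ x, g 0 x * (kin (N + M) 0 x - T) ∂((pinnedChain ω₂ lam β γ).gibbsMeasure (N + M) T)) -
          ∫ y, gN y * (kin N 0 y - T) ∂((pinnedChain ω₂ lam β γ).gibbsMeasure N T)) := by
  rw [kuboMatrix_zero_zero, plainKubo]
  ring

/-- **Kubo-form bookkeeping of the right block.** `K_33 − G_M = −(γ²/T²)(⟨g_3, p_{N+M−1}² − T⟩_{μ^{N+M}} −
⟨g_M, p_0² − T⟩_{μ^M})` (the bare `M`-chain enters through its LEFT forward field). -/
theorem kuboMatrix_three_three_sub_plainKubo (N M : ℕ) (g : Fin 4 → PhaseSpace (N + M) → ℝ)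
    (gM : PhaseSpace M → ℝ) :
    kuboMatrix ω₂ lam β γ T N M g 3 3 - plainKubo ω₂ lam β γ T M gM =
      -(γ ^ 2 / T ^ 2) *
        ((∫ x, g 3 x * (kin (N + M) (N + M - 1) x - T) ∂((pinnedChain ω₂ lam β γ).gibbsMeasure (N + M) T)) -
          ∫ y, gM y * (kin M 0 y - T) ∂((pinnedChain ω₂ lam β γ).gibbsMeasure M T)) := by
  rw [kuboMatrix_three_three, plainKubo]
  ring

end Kubo

/-! ## From a division-free conductance defect to the resistance form -/

section Algebra

/-- `K − G ≤ C·G·K` with `G, K > 0` gives `1/G − 1/K ≤ C`. -/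
theorem one_div_sub_one_div_le_of_defect {G K C : ℝ} (hG : 0 < G) (hK : 0 < K)
    (h : K - G ≤ C * G * K) : 1 / G - 1 / K ≤ C := by
  have e : 1 / G - 1 / K = (K - G) / (G * K) := by
    field_simp
  rw [e, div_le_iff₀ (mul_pos hG hK)]
  linarith

/-- `K − G ≤ c G²` with `G, K > 0` gives `1/G − 1/K ≤ max c 0` (the sister line's form
`a ≤ G_N (1 + c G_N)` of TL⁺). -/
theorem one_div_sub_one_div_le_of_sq_defect {G K c : ℝ} (hG : 0 < G) (hK : 0 < K)
    (h : K - G ≤ c * G ^ 2) : 1 / G - 1 / K ≤ max c 0 := by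
  rcases le_or_gt G K with hGK | hGK
  · -- `G ≤ K`: `(K − G)/(GK) ≤ c G²/(GK) = c G/K ≤ max c 0`
    have e : 1 / G - 1 / K = (K - G) / (G * K) := by
      field_simp
    rw [e, div_le_iff₀ (mul_pos hG hK)]
    have h1 : c * G ^ 2 ≤ max c 0 * G ^ 2 :=
      mul_le_mul_of_nonneg_right (le_max_left _ _) (sq_nonneg _)
    have h2 : max c 0 * G ^ 2 ≤ max c 0 * (G * K) := by
      refine mul_le_mul_of_nonneg_left ?_ (le_max_right _ _)
      nlinarith
    linarith
  · -- `K < G`: the left-hand side is negative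
    have h1 : 1 / G < 1 / K := one_div_lt_one_div_of_lt hK hGK
    have h2 : (0 : ℝ) ≤ max c 0 := le_max_right _ _
    linarith

/-- Conversely `1/G − 1/K ≤ C` with `G, K > 0` gives the division-free `K − G ≤ C·G·K`. -/
theorem defect_le_of_one_div_sub_one_div_le {G K C : ℝ} (hG : 0 < G) (hK : 0 < K)
    (h : 1 / G - 1 / K ≤ C) : K - G ≤ C * G * K := by
  have e : 1 / G - 1 / K = (K - G) / (G * K) := by
    field_simp
  rw [e, div_le_iff₀ (mul_pos hG hK)] at h
  linarith

end Algebra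

/-- Registered helper sub-goal `helper_terminationDefect` (= `deviceGenerator_defect` in stub form,
block map written out): the defect equation `L_dev (g_0 − g_N ∘ π_N) = −V'(r_J) (∂_{p_{N−1}} g_N) ∘ π_N`. -/
theorem helper_terminationDefect : ∀ (ω₂ lam β γ T : ℝ) {N M : ℕ} (hN : 1 ≤ N) (hM : 1 ≤ M) {g₀ : PhaseSpace (N + M) → ℝ} {gN : PhaseSpace N → ℝ}, ContDiff ℝ 2 g₀ → ContDiff ℝ 2 gN → (∀ x, deviceGenerator (pinnedChain ω₂ lam β γ) N M (fun _ => T) g₀ x = -(kin (N + M) 0 x - T)) → (∀ y, (pinnedChain ω₂ lam β γ).generator N T T gN y = -(kin N 0 y - T)) → ∀ x : PhaseSpace (N + M), deviceGenerator (pinnedChain ω₂ lam β γ) N M (fun _ => T) (fun y => g₀ y - gN (y.1 ∘ Fin.castAdd M, y.2 ∘ Fin.castAdd M)) x = -(((x.1 ⟨N, by omega⟩ - x.1 ⟨N - 1, by omega⟩) + β * (x.1 ⟨N, by omega⟩ - x.1 ⟨N - 1, by omega⟩) ^ 3) * partialP ⟨N - 1, by omega⟩ gN (x.1 ∘ Fin.castAdd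 M, x.2 ∘ Fin.castAdd M)) :=
  fun ω₂ lam β γ T _ _ hN hM _ _ hg₀ hgN hpde₀ hpdeN x =>
    deviceGenerator_defect ω₂ lam β γ T hN hM hg₀ hgN hpde₀ hpdeN x

end Summit.AtomisticToContinuum.FouriersLaw.Theorems.SuperadditiveResistance.TerminationLocality

end
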